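import Summits.FinalStateConjecture.FinalStateConjecture.Theorems.SwallowTheDatumParametricKerrBurialLine

/-!
# Vocabulary and glue of the line `null-shell-shadow-collar` (crux `SwallowTheDatum.ParametricKerrBurial`,
# item stmt-FinalStateConjecture-10052) — second line lead

Support file of the SECOND collar line of the crux.  It extends the first line's vocabulary file
`SwallowTheDatumParametricKerrBurialLine.lean` (`SmoothSectionsOn`, `AgreeAt`, `IsExactSchwarzschildBeyond`,
`IsSchwarzschildAnnulus`, `IsKerrShielded`, `IsKerrShieldedAway`, the proved `junction` lemma) by

* §0 the COLLAR predicate `IsCollar l μ C` — a datum on `E3` which is a vacuum constraint solution OUTSIDE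
  the ball of radius `l` (no Corvino core: the ball is discarded by the transfer), exactly isotropic
  Schwarzschild(`l μ`), `k = 0`, on the annulus `{l < ‖y‖ < 2 l}`, exactly time-symmetric isotropic
  Schwarzschild(`M_end`) beyond some radius (so that the END clauses of admissibility come, after transport
  to any `X`, from the decay of `(1 + M/2r)⁴ − (1 + 2M/r)`, as in
  `SwallowTheDatumKerrShieldedDataExistStubIsotropicEnd.lean`), and Kerr-shielded with the crux's conjuncts
  verbatim by a chart ranging in `{2 l < ‖y‖}` (`IsKerrShieldedAway (2 l)`);
* §1 the ENGINE vocabulary of this line, all at ZERO SPIN: the model Schwarzschild cylinder map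
  `schwCylMap r₀ τ₀ : y ↦ (t* = ‖y‖ + τ₀, x = r₀ y/‖y‖)` onto the spacelike cylinder `{r = r₀ < 2M}` inside
  the black hole of the ingoing Kerr–Schild chart, `NearSchwarzschildCylinder` (sup-`C^k` closeness of a
  datum to the cylinder data on an annulus), `IsSchwarzschildCylinderOn` (exact cylinder data), and the
  Klein-four symmetry `IsKleinSymmetricOn` (invariance under the rotations by `π` about the three axes —
  it has no invariant vector, so an EQUIVARIANT interior gluing lands on Kerr(`m, a⃗ = 0`) =
  Schwarzschild(`m`), which keeps the whole line at zero spin, where the tree's closed forms live);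
* §2 the sorry-free COMPOSITIONS, with the seven STUB STATEMENTS of the line written out as hypotheses
  (no closed `Prop` is declared — stub statements are registered on the crux item, not vendored as facts):
  `universalCollar_of` : shadow collar → equivariant interior Schwarzschild gluing → Schwarzschild cylinder
  capping → universal collar (`∃ μ ≤ μ₀, ∃ C, IsCollar 1 μ C`), and `ParametricKerrBurial_of_collarLine` :
  far gluing (= the first line's registered `stub_farGluing`, SHARED) → universal collar → collar dilation →
  transport-and-patch (the first line's dilation / transport stubs over the WEAKER hypothesis `IsCollar`, so
  they imply the first line's versions) → breathing (= the first line's `stub_breathing`, SHARED) →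
  `ParametricKerrBurial` BY NAME (last step: the first line's proved `junction`).

Nothing is asserted: parametrised predicates and two glue theorems.  References: `Theses/SwallowTheDatum.lean`
(item 10052); `Cruxes/ParametricKerrBurial/Lines/null-shell-shadow-collar.md`; Li–Mei arXiv:2005.01249
Prop. 4.1 / Thm 2.2 and §2.1; Luk–Rodnianski arXiv:2009.08968 Thm 1.9/1.10/1.12; Mao–Oh–Tao
arXiv:2308.13031 Thm 1.7/1.10; Corvino–Schoen gr-qc/0301071; Bartnik, CPAM 39 (1986) §1.
-/

-- `Summit.<Summit>.<Problem>` is the tree's mandated summit-side namespace (CONVENTIONS §2); for this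
-- single-conjunct summit the two coincide, so the duplicate is deliberate.
set_option linter.dupNamespace false

noncomputable section

namespace Summit.FinalStateConjecture.FinalStateConjecture.Theorems.SwallowTheDatum.ParametricKerrBurial

open scoped Manifold ContDiff Topology
open Bundle Set Filter Function Literature.Geometry.Lorentzian

/-! ## §0 The collar predicate -/

section Collar

/-- Vacuum constraints of a datum on `E3` on a subset `s` (same Levi-Civita binder as
`admissibleVacuumData`). Choquet-Bruhat 2009, Ch. VI, Thm. 3.3. [folklore] -/
def VacuumOn (s : Set E3) (D : InitialDataSet (𝓡 3) E3) : Prop :=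
  ∀ [D.metric.HasLeviCivita], ∀ y ∈ s, D.hamiltonianConstraintFn y = 0 ∧ D.momentumConstraintFn y = 0

/-- Beyond radius `R` the datum on `E3` is EXACTLY the time-symmetric isotropic Schwarzschild(`M`) slice,
`h = (1 + M/(2‖y‖))⁴ δ`, `k = 0` (the form whose end clauses — sole end, Dafermos–Rodnianski decay — are
the decay of `(1 + M/2r)⁴ − (1 + 2M/r) = O₂(r⁻²)`). Misner–Thorne–Wheeler 1973, (31.22). [folklore] -/
def IsIsotropicBeyond (M R : ℝ) (D : InitialDataSet (𝓡 3) E3) : Prop :=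
  ∀ y : E3, R < ‖y‖ →
    D.h.inner y = (1 + M / (2 * ‖y‖)) ^ 4 • (innerSL ℝ : E3 →L[ℝ] E3 →L[ℝ] ℝ) ∧ D.k y = 0

/-- **The collar at scale `l` with annulus mass parameter `μ`.** A datum `C` on `E3` which solves the
vacuum constraints OUTSIDE the closed ball of radius `l` (the ball is never used downstream), is exactly
time-symmetric isotropic Schwarzschild(`l μ`) on the annulus `{l < ‖y‖ < 2 l}`, is exactly
time-symmetric isotropic Schwarzschild(`M_end`), `M_end ≥ 0`, beyond some radius `R_end > 0`, and is
Kerr-shielded with the crux's conjuncts verbatim by a chart ranging in `{2 l < ‖y‖}`.  At `l = 1` this is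
the universal collar of the collar lines; the predicate is dilation-covariant by design. [folklore] -/
def IsCollar [Kerr.Facts] (l μ : ℝ) (C : InitialDataSet (𝓡 3) E3) : Prop :=
  VacuumOn {y | l < ‖y‖} C ∧
  (∃ Mend Rend : ℝ, 0 ≤ Mend ∧ 0 < Rend ∧ IsIsotropicBeyond Mend Rend C) ∧
  (∀ y : E3, l < ‖y‖ → ‖y‖ < 2 * l →
    C.h.inner y = (1 + l * μ / (2 * ‖y‖)) ^ 4 • (innerSL ℝ : E3 →L[ℝ] E3 →L[ℝ] ℝ) ∧ C.k y = 0) ∧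
  IsKerrShieldedAway (2 * l) C

end Collar

/-! ## §1 Engine vocabulary (zero spin) -/

section Engine

/-- The MODEL SCHWARZSCHILD CYLINDER MAP `y ↦ (t* = ‖y‖ + τ₀, x = r₀ y/‖y‖)`, `E3 ∖ {0} → E4`: it maps the
annulus `{ρ₁ < ‖y‖ < ρ₂}` diffeomorphically onto the piece `t* ∈ (ρ₁ + τ₀, ρ₂ + τ₀)` of the cylinder
`{r = r₀}` of the ingoing Kerr–Schild chart of Schwarzschild; for `0 < r₀ < 2M` that cylinder is a
SPACELIKE homogeneous hypersurface inside the black hole (Li–Mei arXiv:2005.01249 §4: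
`ḡ_m = (2m/r₀ − 1) dt² + r₀² dΩ²`, `t* = t + const` on `{r = r₀}`). [folklore] -/
def schwCylMap (r₀ τ₀ : ℝ) (y : E3) : E4 := E4.ofTimeSpace (‖y‖ + τ₀) ((r₀ / ‖y‖) • y)

open scoped Classical in
/-- **Near-Schwarzschild-cylinder data**: on the annulus `{ρ₁ < ‖y‖ < ρ₂}` the datum `D` on `E3` is
`ε`-close in sup-`C^k` (all Cartesian derivatives of order `≤ k` of the differences, on unit test vectors)
to the data induced by Schwarzschild(`M`) (Kerr–Schild chart `Kerr.region 0 r₁`, `r₁ < r₀ < 2M`) on the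
cylinder `{r = r₀}` along `schwCylMap r₀ 0`, `k` taken w.r.t. the FUTURE unit normal of the tree's time
orientation.  The frame `(ψ, ν)` is pinned by the pointwise equation `ψ = schwCylMap r₀ 0` and by
`IsFutureUnitNormal`.  Input of Li–Mei arXiv:2005.01249 Prop. 4.1 (their `C^{k,α}(ḡ_{m₀})`-closeness on
`H ≅ (t₁, t₂) × S²`). [folklore] -/
def NearSchwarzschildCylinder [Kerr.Facts] (M r₁ r₀ ρ₁ ρ₂ : ℝ) (k : ℕ) (ε : ℝ)
    (D : InitialDataSet (𝓡 3) E3) : Prop :=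
  ∃ (hM : 0 ≤ M) (ψ : Kerr.slice 0 1 → Kerr.region 0 r₁) (ν : NormalField 𝓘(ℝ, E4) ψ),
    (∀ y : Kerr.slice 0 1, (ψ y : E4) = schwCylMap r₀ 0 (y : E3)) ∧
    (Kerr.smoothMetric M 0 r₁).IsSpacelikeImmersion 𝓘(ℝ, E3) ψ ∧
    (Kerr.smoothMetric M 0 r₁).IsFutureUnitNormal 𝓘(ℝ, E3)
      ((Kerr.timeOrientation M 0 r₁ hM).ofLE le_top) ψ ν ∧
    ∀ (v w : E3), ‖v‖ ≤ 1 → ‖w‖ ≤ 1 → ∀ i ≤ k, ∀ y : E3, ρ₁ < ‖y‖ → ‖y‖ < ρ₂ →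
      ‖iteratedFDeriv ℝ i (fun z : E3 ↦ D.h.inner z v w -
          (if hz : z ∈ Kerr.slice 0 1 then
            pullbackBilin (I := 𝓘(ℝ, E4)) (I' := 𝓘(ℝ, E3)) ψ
              (Kerr.smoothMetric M 0 r₁).val ⟨z, hz⟩ v w
           else 0)) y‖ ≤ ε ∧
      ∀ [(Kerr.smoothMetric M 0 r₁).HasLeviCivita],
        ‖iteratedFDeriv ℝ i (fun z : E3 ↦ D.k z v w -
          (if hz : z ∈ Kerr.slice 0 1 then
            (Kerr.smoothMetric M 0 r₁).secondFundamentalForm 𝓘(ℝ, E3) ψ ν ⟨z, hz⟩ v w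
           else 0)) y‖ ≤ ε

/-- **Exact Schwarzschild-cylinder data on `s ⊆ {1 < ‖y‖}`**: `h = ψ^* g_m`, `k = K_ν(ψ)` for
`ψ = schwCylMap r₀ τ₀` into `Kerr.region 0 r₁` (`r₁ < r₀`) with its future unit normal `ν` — the OUTPUT of
the (equivariant) interior gluing and the INPUT of the cap. [folklore] -/
def IsSchwarzschildCylinderOn [Kerr.Facts] (m r₀ τ₀ : ℝ) (s : Set E3)
    (D : InitialDataSet (𝓡 3) E3) : Prop :=
  ∃ (r₁ : ℝ) (hm : 0 ≤ m) (ψ : Kerr.slice 0 1 → Kerr.region 0 r₁) (ν : NormalField 𝓘(ℝ, E4) ψ),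
    r₁ < r₀ ∧
    (∀ y : Kerr.slice 0 1, (ψ y : E4) = schwCylMap r₀ τ₀ (y : E3)) ∧
    (Kerr.smoothMetric m 0 r₁).IsSpacelikeImmersion 𝓘(ℝ, E3) ψ ∧
    (Kerr.smoothMetric m 0 r₁).IsFutureUnitNormal 𝓘(ℝ, E3)
      ((Kerr.timeOrientation m 0 r₁ hm).ofLE le_top) ψ ν ∧
    (∀ y : Kerr.slice 0 1, (y : E3) ∈ s →
      D.h.inner (y : E3) =
        pullbackBilin (I := 𝓘(ℝ, E4)) (I' := 𝓘(ℝ, E3)) ψ (Kerr.smoothMetric m 0 r₁).val y) ∧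
    (∀ [(Kerr.smoothMetric m 0 r₁).HasLeviCivita] (y : Kerr.slice 0 1), (y : E3) ∈ s →
      (D.k (y : E3)).toLinearMap₁₂ =
        (Kerr.smoothMetric m 0 r₁).secondFundamentalForm 𝓘(ℝ, E3) ψ ν y)

/-- The rotation by `π` about the `i`-th coordinate axis of `E3` (negate the two other coordinates):
the three of them generate the Klein four-group `V ⊂ SO(3)`, which has NO nonzero invariant vector.
[folklore] -/
def axisFlip (i : Fin 3) (y : E3) : E3 :=
  WithLp.toLp 2 fun j ↦ if j = i then y j else -(y j)

/-- **Klein-four symmetry of a datum on the ball `{‖y‖ < ρ}`**: both sections are invariant under the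
three rotations by `π` about the coordinate axes (componentwise: `h_{g y}(g v, g w) = h_y(v, w)`, same for
`k`; tangent spaces of `E3` are `E3`).  An interior gluing performed EQUIVARIANTLY on such a datum lands on
a `V`-invariant member of the Kerr family `(m, a⃗)`, i.e. on `a⃗ = 0` — Schwarzschild(`m`). [folklore] -/
def IsKleinSymmetricOn (ρ : ℝ) (D : InitialDataSet (𝓡 3) E3) : Prop :=
  ∀ (i : Fin 3) (y v w : E3), ‖y‖ < ρ →
    D.h.inner (axisFlip i y) (axisFlip i v) (axisFlip i w) = D.h.inner y v w ∧
      D.k (axisFlip i y) (axisFlip i v) (axisFlip i w) = D.k y v w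

end Engine

/-! ## §2 The two compositions (stub statements as hypotheses) -/

/-- **The engine** (stub statements as hypotheses): SHADOW COLLAR `hS` (the lever, hyperbolic, unprinted:
for every seed mass `μ ∈ (0,1]` a `δ`-independent geometry `0 < r₁ < r₀ < 2M`, `2 ≤ ρ₁ < ρ₂` such that for every
`k, ε` a member of the Schwarzschild(`μ`)-seeded Klein-symmetric short-pulse family carries a slice whose data on
`E3` are vacuum on `{1 < ‖y‖ < ρ₂}`, exactly iso-Schwarzschild(`μ`) on `{1 < ‖y‖ < 2}`, Klein-symmetric, and
`ε`-`C^k`-close on `{ρ₁ < ‖y‖ < ρ₂}` to the interior Schwarzschild(`M`) cylinder `{r = r₀}` — Luk–Rodnianski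
arXiv:2009.08968 Thm 1.9/1.10/1.12, Lemma 10.2 + Birkhoff on the limit; Li–Mei arXiv:2005.01249 §2.1 seed)
+ EQUIVARIANT INTERIOR SCHWARZSCHILD GLUING `hG` (Li–Mei Prop 4.1 under the Klein four-group: only `∂_t` of
the cokernel is invariant, absorbed by the mass, so the glued outer piece is the exact Schwarzschild(`m`)
cylinder, `0 < r₀ < 2m`) + SCHWARZSCHILD CYLINDER CAPPING `hC` (explicit: continue the cylinder, turn right in
the `(t*, r)` plane, exit on a Kerr–Schild slice, bend, reparametrise to the isotropic end) give the UNIVERSAL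
COLLAR: for every `μ₀ > 0` some `μ ≤ μ₀` and a datum `C` with `IsCollar 1 μ C`.  First-order plumbing:
`μ := min μ₀ 1`; geometry; `(k, ε)`; `D ↦ D' ↦ C`; exactness on `{1 < ‖y‖ < 2} ⊆ {‖y‖ < ρ₁}` survives both
modifications; the shield beyond `ρ' > ρ₁ ≥ 2` is a shield beyond `2`. [folklore] -/
theorem universalCollar_of :
    (∀ [Kerr.Facts], ∀ μ : ℝ, 0 < μ → μ ≤ 1 →
      ∃ (M r₁ r₀ ρ₁ ρ₂ : ℝ), 0 < r₁ ∧ r₁ < r₀ ∧ r₀ < 2 * M ∧ 2 ≤ ρ₁ ∧ ρ₁ < ρ₂ ∧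
        ∀ (k : ℕ) (ε : ℝ), 0 < ε →
          ∃ D : InitialDataSet (𝓡 3) E3,
            VacuumOn {y | 1 < ‖y‖ ∧ ‖y‖ < ρ₂} D ∧ IsSchwarzschildAnnulus D μ ∧
            IsKleinSymmetricOn ρ₂ D ∧ NearSchwarzschildCylinder M r₁ r₀ ρ₁ ρ₂ k ε D) →
    (∀ [Kerr.Facts], ∀ (M r₁ r₀ ρ₁ ρ₂ : ℝ), 0 < r₁ → r₁ < r₀ → r₀ < 2 * M → 2 ≤ ρ₁ → ρ₁ < ρ₂ →
      ∃ (k : ℕ) (ε : ℝ), 0 < ε ∧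
        ∀ D : InitialDataSet (𝓡 3) E3,
          VacuumOn {y | 1 < ‖y‖ ∧ ‖y‖ < ρ₂} D → IsKleinSymmetricOn ρ₂ D →
          NearSchwarzschildCylinder M r₁ r₀ ρ₁ ρ₂ k ε D →
          ∃ (D' : InitialDataSet (𝓡 3) E3) (m τ₀ ρ' : ℝ),
            (∀ y : E3, ‖y‖ < ρ₁ → D'.h.inner y = D.h.inner y ∧ D'.k y = D.k y) ∧
            VacuumOn {y | 1 < ‖y‖ ∧ ‖y‖ < ρ₂} D' ∧
            0 < r₀ ∧ r₀ < 2 * m ∧ ρ₁ < ρ' ∧ ρ' < ρ₂ ∧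
            IsSchwarzschildCylinderOn m r₀ τ₀ {y | ρ' < ‖y‖ ∧ ‖y‖ < ρ₂} D') →
    (∀ [Kerr.Facts], ∀ (D' : InitialDataSet (𝓡 3) E3) (m r₀ τ₀ ρ' ρ₂ : ℝ),
      1 ≤ ρ' → ρ' < ρ₂ → 0 < r₀ → r₀ < 2 * m →
      VacuumOn {y | 1 < ‖y‖ ∧ ‖y‖ < ρ₂} D' →
      IsSchwarzschildCylinderOn m r₀ τ₀ {y | ρ' < ‖y‖ ∧ ‖y‖ < ρ₂} D' →
      ∃ C : InitialDataSet (𝓡 3) E3,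
        (∀ y : E3, ‖y‖ ≤ ρ' → C.h.inner y = D'.h.inner y ∧ C.k y = D'.k y) ∧
        VacuumOn {y | 1 < ‖y‖} C ∧
        (∃ Mend Rend : ℝ, 0 ≤ Mend ∧ 0 < Rend ∧ IsIsotropicBeyond Mend Rend C) ∧
        IsKerrShieldedAway ρ' C) →
    ∀ [Kerr.Facts], ∀ μ₀ : ℝ, 0 < μ₀ → ∃ μ : ℝ, 0 < μ ∧ μ ≤ μ₀ ∧
      ∃ C : InitialDataSet (𝓡 3) E3, IsCollar 1 μ C := by
  intro hS hG hC _inst μ₀ hμ₀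
  have hμpos : 0 < min μ₀ 1 := lt_min hμ₀ one_pos
  have hμ1 : min μ₀ 1 ≤ 1 := min_le_right _ _
  obtain ⟨M, r₁, r₀, ρ₁, ρ₂, hr₁, hr₁₀, hr₀, hρ₁, hρ₁₂, hfam⟩ := hS (min μ₀ 1) hμpos hμ1
  obtain ⟨k, ε, hε, hglue⟩ := hG M r₁ r₀ ρ₁ ρ₂ hr₁ hr₁₀ hr₀ hρ₁ hρ₁₂
  obtain ⟨D, hvac, hiso, hsym, hnear⟩ := hfam k ε hε
  obtain ⟨D', m, τ₀, ρ', hagree, hvac', hr₀pos, hr₀m, hρ', hρ'₂, hcyl⟩ := hglue D hvac hsym hnear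
  obtain ⟨C, hagree', hvacC, hend, hsh⟩ :=
    hC D' m r₀ τ₀ ρ' ρ₂ (by linarith) hρ'₂ hr₀pos hr₀m hvac' hcyl
  refine ⟨min μ₀ 1, hμpos, min_le_left _ _, C, hvacC, hend, ?_, ?_⟩
  · intro y hy1 hy2
    have hyρ₁ : ‖y‖ < ρ₁ := by linarith
    have hyρ' : ‖y‖ ≤ ρ' := by linarith
    obtain ⟨e1, e2⟩ := hagree' y hyρ'
    obtain ⟨e3, e4⟩ := hagree y hyρ₁
    obtain ⟨e5, e6⟩ := hiso y hy1 (by linarith)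
    refine ⟨?_, by rw [e2, e4, e6]⟩
    rw [e1, e3, e5, one_mul]
  · -- the shield of `C` ranges beyond `ρ' > ρ₁ ≥ 2 = 2 * 1`
    obtain ⟨M', a', r₁', hM', T, φ, ψ, ν, h0, hrest⟩ := hsh
    exact ⟨M', a', r₁', hM', T, φ, ψ, ν, fun z ↦ by linarith [h0 z], hrest⟩

/-- **`ParametricKerrBurial` from the stubs of the line `null-shell-shadow-collar`** (CONDITIONAL glue; hypotheses
= the stub statements: FAR GLUING `hA` — the first line's registered `stub_farGluing` verbatim (Mao–Oh–Tao
arXiv:2308.13031 Thm 1.7/1.10 receding far-annulus gluing onto a growing isotropic Schwarzschild seed, smooth in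
the radius); UNIVERSAL COLLAR `hU` — the conclusion of `universalCollar_of`; COLLAR DILATION `hDil` — the dilates
`(h_l)_{ij}(y) = h_{ij}(y/l)`, `(k_l)_{ij}(y) = l⁻¹ k_{ij}(y/l)` of a collar form a family smooth on `{0 < l} × E3`
with `IsCollar l μ (C_l)`; TRANSPORT-AND-PATCH `hPatch` — `P R := G R` off `e.far (3λ/2)` and the collar `C_λ`,
`λ := m R/μ ≥ 32 R`, transported by the chart of `e`, on `e.far λ` (they agree on the overlap) is admissible,
shielded, `= G R` off `e.far (32 R)`, smooth in `(R, x)`; BREATHING `hBreathe` — the first line's registered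
`stub_breathing` verbatim (injectivity device)): far gluing gives `η, e, R⋆, m, G`; the universal collar at
`μ₀ := η/32` the collar; dilation, transport + patch the radius-indexed admissible shielded family `P` with
`P R = d` off `e.far R`; breathing the families `S, E` and the marker; the first line's `junction` the typed
family `F`. [folklore] -/
theorem ParametricKerrBurial_of_collarLine :
    (∀ (X : Type) [TopologicalSpace X] [ChartedSpace E3 X] [IsManifold (𝓡 3) ∞ X] [T2Space X]
      [SecondCountableTopology X] [ConnectedSpace X], ∀ d ∈ admissibleVacuumData X,
      ∃ (η : ℝ) (e : AFEnd X) (Rstar : ℝ) (m : ℝ → ℝ) (G : ℝ → InitialDataSet (𝓡 3) X),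
        0 < η ∧ e.IsSoleEnd ∧ e.R < Rstar ∧ ContDiff ℝ ∞ m ∧
        SmoothSectionsOn 𝓘(ℝ, ℝ) G {p : ℝ × X | Rstar < p.1} ∧
        ∀ R : ℝ, Rstar < R → G R ∈ admissibleVacuumData X ∧ (∀ x ∉ e.far R, AgreeAt (G R) d x) ∧
          η * R ≤ m R ∧ IsExactSchwarzschildBeyond e (G R) (m R) (32 * R)) →
    (∀ [Kerr.Facts], ∀ μ₀ : ℝ, 0 < μ₀ → ∃ μ : ℝ, 0 < μ ∧ μ ≤ μ₀ ∧
      ∃ C : InitialDataSet (𝓡 3) E3, IsCollar 1 μ C) →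
    (∀ [Kerr.Facts] (C : InitialDataSet (𝓡 3) E3) (μ : ℝ), 0 < μ → IsCollar 1 μ C →
      ∃ Cfam : ℝ → InitialDataSet (𝓡 3) E3,
        SmoothSectionsOn 𝓘(ℝ, ℝ) Cfam {p : ℝ × E3 | 0 < p.1} ∧ ∀ l : ℝ, 0 < l → IsCollar l μ (Cfam l)) →
    (∀ [Kerr.Facts] (X : Type) [TopologicalSpace X] [ChartedSpace E3 X] [IsManifold (𝓡 3) ∞ X]
      [T2Space X] [SecondCountableTopology X] [ConnectedSpace X] (e : AFEnd X) (Rstar η μ : ℝ)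
      (m : ℝ → ℝ) (G : ℝ → InitialDataSet (𝓡 3) X) (Cfam : ℝ → InitialDataSet (𝓡 3) E3),
      e.IsSoleEnd → e.R < Rstar → 0 < μ → 32 * μ ≤ η → ContDiff ℝ ∞ m →
      SmoothSectionsOn 𝓘(ℝ, ℝ) G {p : ℝ × X | Rstar < p.1} →
      (∀ R : ℝ, Rstar < R → G R ∈ admissibleVacuumData X ∧ η * R ≤ m R ∧
        IsExactSchwarzschildBeyond e (G R) (m R) (32 * R)) →
      SmoothSectionsOn 𝓘(ℝ, ℝ) Cfam {p : ℝ × E3 | 0 < p.1} →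
      (∀ l : ℝ, 0 < l → IsCollar l μ (Cfam l)) →
      ∃ P : ℝ → InitialDataSet (𝓡 3) X, SmoothSectionsOn 𝓘(ℝ, ℝ) P {p : ℝ × X | Rstar < p.1} ∧
        ∀ R : ℝ, Rstar < R → P R ∈ admissibleVacuumData X ∧ IsKerrShielded X (P R) ∧
          ∀ x ∉ e.far (32 * R), AgreeAt (P R) (G R) x) →
    (∀ [Kerr.Facts] (X : Type) [TopologicalSpace X] [ChartedSpace E3 X] [IsManifold (𝓡 3) ∞ X]
      [T2Space X] [SecondCountableTopology X] [ConnectedSpace X] (d : InitialDataSet (𝓡 3) X)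
      (e : AFEnd X) (Rstar : ℝ) (P : ℝ → InitialDataSet (𝓡 3) X), e.R < Rstar →
      SmoothSectionsOn 𝓘(ℝ, ℝ) P {p : ℝ × X | Rstar < p.1} →
      (∀ R : ℝ, Rstar < R → P R ∈ admissibleVacuumData X ∧ IsKerrShielded X (P R) ∧
        ∀ x ∉ e.far R, AgreeAt (P R) d x) →
      ∃ (S : ℝ × ℝ → InitialDataSet (𝓡 3) X) (E : ℝ → InitialDataSet (𝓡 3) X) (x₀ : X)
        (v₀ : TangentSpace (𝓡 3) x₀),
        SmoothSectionsOn (𝓘(ℝ, ℝ).prod 𝓘(ℝ, ℝ)) S {p : (ℝ × ℝ) × X | Rstar < p.1.1} ∧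
        SmoothSectionsOn 𝓘(ℝ, ℝ) E (Set.univ : Set (ℝ × X)) ∧ E 0 = d ∧
        (∀ R t : ℝ, Rstar < R → ∀ x ∉ e.far R, AgreeAt (S (R, t)) (E t) x) ∧ x₀ ∉ e.far Rstar ∧
        Set.InjOn (fun t : ℝ ↦ (E t).h.inner x₀ v₀ v₀) (Set.Ioo (-1) 1) ∧
        ∀ R t : ℝ, Rstar < R → |t| < 1 → S (R, t) ∈ admissibleVacuumData X ∧ IsKerrShielded X (S (R, t))) →
    Summit.FinalStateConjecture.FinalStateConjecture.Theses.SwallowTheDatum.ParametricKerrBurial := by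
  intro hA hU hDil hPatch hBreathe _inst X _ _ _ _ _ _ d hd
  obtain ⟨η, e, Rstar, m, G, hη, hsole, heR, hm, hGs, hG⟩ := hA X d hd
  obtain ⟨μ, hμ, hμle, C, hC⟩ := hU (η / 32) (by positivity)
  have h32 : 32 * μ ≤ η := by linarith
  obtain ⟨Cfam, hCs, hCfam⟩ := hDil C μ hμ hC
  obtain ⟨P, hPs, hP⟩ := hPatch X e Rstar η μ m G Cfam hsole heR hμ h32 hm hGs
    (fun R hR ↦ ⟨(hG R hR).1, (hG R hR).2.2.1, (hG R hR).2.2.2⟩) hCs hCfam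
  have hRpos : ∀ R : ℝ, Rstar < R → 0 ≤ R := fun R hR ↦ by linarith [e.R_pos]
  have hPd : ∀ R : ℝ, Rstar < R → P R ∈ admissibleVacuumData X ∧ IsKerrShielded X (P R) ∧
      ∀ x ∉ e.far R, AgreeAt (P R) d x := by
    intro R hR
    refine ⟨(hP R hR).1, (hP R hR).2.1, fun x hx ↦ ?_⟩
    have hx' : x ∉ e.far (32 * R) := fun h ↦ hx (e.far_mono (by nlinarith [hRpos R hR]) h)
    obtain ⟨h1, h2⟩ := (hP R hR).2.2 x hx'
    obtain ⟨h3, h4⟩ := (hG R hR).2.1 x hx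
    exact ⟨h1.trans h3, h2.trans h4⟩
  obtain ⟨S, E, x₀, v₀, hSs, hEs, hE0, hSE, hx₀, hmark, hgood⟩ := hBreathe X d e Rstar P heR hPs hPd
  obtain ⟨F, hF, hF0, hFinj, hmem⟩ := junction d e Rstar S E x₀ v₀ hSs hEs hE0 hSE hx₀ hmark
  refine ⟨F, hF, hF0, hFinj, fun c ↦ ?_, fun c hc ↦ ?_⟩
  · by_cases hc : c = 0
    · subst hc; rw [hF0]; exact hd
    · obtain ⟨R, t, hR, ht, hFc⟩ := hmem c hc
      rw [hFc]; exact (hgood R t hR ht).1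
  · obtain ⟨R, t, hR, ht, hFc⟩ := hmem c hc
    rw [hFc]; exact (hgood R t hR ht).2

end Summit.FinalStateConjecture.FinalStateConjecture.Theorems.SwallowTheDatum.ParametricKerrBurial

end
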